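import Literature.Probability.Percolation.TriDiscSeparation
import Literature.Probability.Percolation.TriPolyhexDisc
import Literature.Probability.Percolation.LandedAltFourArm
import HarnessLib

/-!
# The hexagon `Λ_N` as a disc: interleaved paths of disjoint classes do not coexist

Topic `Literature/Probability/Percolation`; family `crit-perc` / near-critical percolation on `𝕋`.
A brick of the arm-separation theorem for FOUR arms of alternating colours (Nolin 2008, Thm. 11
[arXiv 0711.4948: Thm. 10], `j = 4`, `σ = BWBW`; the hypothesis of
`altFourArm_quasiMult_of_altSeparation`, `Nolin2008_cor41_of_separation`, …), namely of its
planar-topological input: the cyclic ORDER of arms around an annulus. In print this is "planarity"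
(the arms are curves in counterclockwise order, Nolin §4.1); in the tree the alternating event is
recorded in cluster form (`altFourArm`, `AltFourArm.lean`), and the passage from cluster form to
cyclic order needs a Jordan-type statement for paths between arbitrary points of the hexagon
`∂Λ_N`. The special case of paths between whole opposite SIDES is `hexSides_interleaved_false`
(`LandedAltFourArm.lean`, by a reflection and the Hex lemma); the general case is supplied here by
the disc theory of the tree (Bollobás–Riordan 2006, Ch. 7, Lemma 5, exclusivity half:
`IsTriDisc.not_interleaved`, `TriDiscSeparation.lean`), applied to the hexagon `Λ_N = triBall N`:

* `hexPos N v` — **the perimeter coordinate** of a site of `∂Λ_N`, in `[0, 6N)`, increasing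
  anticlockwise from the corner `(N, -N)`: side `i` (the image under `ρ^i` of the right side
  `{x₀ = N, -N ≤ x₁ < 0}`, `ρ` the rotation by `60°`) carries the values `[iN, (i+1)N)`
  (`hexPos_rot_side0`);
* `isTriDisc_triBall` — `Λ_N` is a disc (`exists_isTriDisc_of_coconnected`: it is connected,
  `pathIn_triBall`, and so is its complement, `triBall_coconnected`, by radial paths and the
  connectedness of the spheres `∂Λ_K`, `pathIn_triSphere`), based at the dart
  `b₀ = ((N,-N) → (N+1,-N-1))`;
* `hexPos_fst_triBdrySucc` — along the anticlockwise boundary traversal of `Λ_N` the perimeter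
  coordinate of the tail does not move or advances by one, except at the single closing dart
  `d⋆ = ((N,-N) → (N,-N-1))` (the predecessor of `b₀`); by the rotation covariance of the
  traversal (`triBdrySucc_rot`) this is a computation on the right side only;
* `hexPos_iter_mono` — hence the tail's perimeter coordinate is non-decreasing along a period of
  the traversal (positions `0, …, #∂ - 2`);
* **`triBall_not_interleaved`** — for sites `x, y, x', y'` of `∂Λ_N` with
  `hexPos x < hexPos y < hexPos x' < hexPos y'`, a path of sites of `Λ_N ∩ B` from `x` to `x'` and a
  path of sites of `Λ_N ∖ B` from `y` to `y'` cannot both exist, for ANY set `B` of sites.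

Typical use (four-arm separation, `sepFourArm ⊆ altFourArm`-type statements): `B` = an open
cluster together with the hole `Λ_{n-1}` of an annulus `Λ_N ∖ Λ_{n-1}` and another open cluster;
the two paths are "open arm – hole – open arm" and "closed arm – … – closed arm". Everything here
is proved; no named facts are introduced.

## References

* B. Bollobás, O. Riordan, *Percolation*, Cambridge University Press (2006), Ch. 7, §7.2.2 and
  Lemma 5 p. 169 (discrete domains; "but not both"). [BollobasRiordan2006]
* P. Nolin, *Near-critical percolation in two dimensions*, Electron. J. Probab. 13 (2008), §4.1
  (arms "in counterclockwise order") and Thm. 11 [arXiv 0711.4948: Thm. 10]. [Nolin2008]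
* H. Kesten, *Percolation theory for mathematicians* (1982), §2.2–2.3 (planarity arguments for
  site percolation on the triangular lattice). [KestenPTM1982]

Tree: `IsTriDisc`, `triBdryIter`, `IsTriDisc.not_interleaved`, `rebase`, `injOn`,
`iter_eq_iter_iff` (`TriDiscShelling.lean`, `TriDiscSeparation.lean`); `triBdryDarts`,
`triBdrySucc`, `triLeftApex` (`TriDiscreteDomain.lean`); `exists_isTriDisc_of_coconnected`
(`TriPolyhexDisc.lean`); `triRotIsoPow`, `rot_apply_formula`, `exists_rot_symm_apply_zero_eq`,
`triNorm_rot(_symm)`, `triRotIsoPow_six_apply` (`ArmSeparationRotate.lean`,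
`TriAnnulusCircuit.lean`); `pathIn_triBall`, `exists_adj_triNorm_eq_sub_one`
(`LandedAltFourArm.lean`); `triGraph_adj_iff_coord`, `triNorm_le_iff_lin`, `le_triNorm_iff_lin`,
`triNorm_le_triNorm_add_one_of_adj'`. The three linearity lemmas for `ρ` (`triRot60_add_of_ballDisc`,
`triRotIsoPow_map_add/sub`) duplicate `triRot60_add`, `triRotIsoPow_apply_add/sub` of
`HexBoundaryGeometry.lean` in a few lines each rather than importing that module, which would pull
the near-critical pivotal cone (`LandedAltPivotalCut`) into this foundational planar file (the same
choice as `ArmSeparationRotate.lean` for `triNorm_triRot60`).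
-/

noncomputable section

open Finset

namespace Literature.Probability.Percolation

open LatticeModels

/-! ### Linearity of the rotation and covariance of the boundary traversal -/

/-- `triRot60` is additive. [folklore] -/
theorem triRot60_add_of_ballDisc (x y : Site 2) : triRot60 (x + y) = triRot60 x + triRot60 y := by
  ext i
  fin_cases i <;> simp [triRot60_apply_zero, triRot60_apply_one] <;> ring

/-- The powers `ρ^i` are additive. [folklore] -/
theorem triRotIsoPow_map_add (i : ℕ) (x y : Site 2) :
    triRotIsoPow i (x + y) = triRotIsoPow i x + triRotIsoPow i y := by
  induction i with
  | zero => rfl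
  | succ i ih => simp only [triRotIsoPow_succ_apply, ih, triRot60_add_of_ballDisc]

/-- The powers `ρ^i` commute with subtraction. [folklore] -/
theorem triRotIsoPow_map_sub (i : ℕ) (x y : Site 2) :
    triRotIsoPow i (x - y) = triRotIsoPow i x - triRotIsoPow i y := by
  rw [eq_sub_iff_add_eq, ← triRotIsoPow_map_add, sub_add_cancel]

/-- `ρ ∘ ρ^i = ρ^i ∘ ρ`. [folklore] -/
theorem triRot60_triRotIsoPow (i : ℕ) (x : Site 2) :
    triRot60 (triRotIsoPow i x) = triRotIsoPow i (triRot60 x) := by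
  rw [← triRotIsoPow_succ_apply, triRotIsoPow_succ_apply']

/-- **The left apex is rotation covariant.** [folklore] -/
theorem triLeftApex_rot (i : ℕ) (x y : Site 2) :
    triLeftApex (triRotIsoPow i x) (triRotIsoPow i y) = triRotIsoPow i (triLeftApex x y) := by
  unfold triLeftApex
  rw [← triRotIsoPow_map_sub, triRot60_triRotIsoPow, ← triRotIsoPow_map_add]

/-- The hexagons `Λ_N` are rotation invariant. [folklore] -/
theorem rot_mem_triBall_iff (i N : ℕ) (z : Site 2) : triRotIsoPow i z ∈ triBall N ↔ z ∈ triBall N := by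
  simp only [mem_triBall_iff, triNorm_rot]

/-- Rotations preserve adjacency. [folklore] -/
theorem rot_adj_iff (i : ℕ) {a b : Site 2} : triGraph.Adj (triRotIsoPow i a) (triRotIsoPow i b) ↔ triGraph.Adj a b :=
  (triRotIsoPow i).map_adj_iff

/-- **The anticlockwise boundary successor of `Λ_N` is rotation covariant.** [folklore] -/
theorem triBdrySucc_rot (i N : ℕ) (x y : Site 2) :
    triBdrySucc (triBall N) (triRotIsoPow i x, triRotIsoPow i y) =
      (triRotIsoPow i (triBdrySucc (triBall N) (x, y)).1, triRotIsoPow i (triBdrySucc (triBall N) (x, y)).2) := by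
  unfold triBdrySucc
  simp only
  rw [triLeftApex_rot]
  by_cases h : triLeftApex x y ∈ triBall N
  · rw [if_pos ((rot_mem_triBall_iff i N _).2 h), if_pos h]
  · rw [if_neg (fun h' => h ((rot_mem_triBall_iff i N _).1 h')), if_neg h]

/-! ### The perimeter coordinate -/

/-- **The perimeter coordinate of `∂Λ_N`**: `0` at the corner `(N, -N)`, increasing anticlockwise,
values `[iN, (i+1)N)` on side `i` = `ρ^i {x₀ = N, -N ≤ x₁ < 0}` (each side taken half-open, from
its first corner inclusive to its last corner exclusive). Explicitly by the six coordinate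
descriptions of the half-open sides. Junk off `∂Λ_N`. [folklore] -/
def hexPos (N : ℕ) (v : Site 2) : ℤ :=
  if v 0 = N ∧ v 1 < 0 then v 1 + N
  else if v 0 + v 1 = N ∧ 0 < v 0 then N + v 1
  else if v 1 = N ∧ 0 < v 0 + v 1 then 2 * N - v 0
  else if v 0 = -(N : ℤ) ∧ 0 < v 1 then 4 * N - v 1
  else if v 0 + v 1 = -(N : ℤ) ∧ v 0 < 0 then 4 * N - v 1
  else 5 * N + v 0

/-- `hexPos` in terms of given coordinates (to evaluate it on explicit points). [folklore] -/
theorem hexPos_of_coord (N : ℕ) (v : Site 2) (a b : ℤ) (h0 : v 0 = a) (h1 : v 1 = b) :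
    hexPos N v = (if a = N ∧ b < 0 then b + N
      else if a + b = N ∧ 0 < a then N + b
      else if b = N ∧ 0 < a + b then 2 * N - a
      else if a = -(N : ℤ) ∧ 0 < b then 4 * N - b
      else if a + b = -(N : ℤ) ∧ a < 0 then 4 * N - b
      else 5 * N + a) := by
  simp only [hexPos, h0, h1]

/-- The perimeter coordinate on the half-open right side: `hexPos N (N, y) = y + N`. [folklore] -/
theorem hexPos_side0 {N : ℕ} {y : ℤ} (hy : -(N : ℤ) ≤ y) (hy0 : y < 0) :
    hexPos N ![(N : ℤ), y] = y + N := by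
  rw [hexPos_of_coord N _ (N : ℤ) y (by simp) (by simp)]
  split_ifs <;> omega

/-- **The perimeter coordinate on side `i`**: `hexPos N (ρ^i (N, y)) = iN + (y + N)` for `i < 6`,
`-N ≤ y < 0`. [folklore] -/
theorem hexPos_rot_side0 {N : ℕ} {i : ℕ} (hi : i < 6) {y : ℤ} (hy : -(N : ℤ) ≤ y) (hy0 : y < 0) :
    hexPos N (triRotIsoPow i ![(N : ℤ), y]) = i * N + (y + N) := by
  obtain rfl | rfl | rfl | rfl | rfl | rfl : i = 0 ∨ i = 1 ∨ i = 2 ∨ i = 3 ∨ i = 4 ∨ i = 5 := by omega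
  · rw [triRotIsoPow_zero_apply, hexPos_side0 hy hy0]; push_cast; ring
  · obtain ⟨-, -, r0, r1, -⟩ := rot_apply_formula ![(N : ℤ), y]
    simp only [Matrix.cons_val_zero, Matrix.cons_val_one] at r0 r1
    rw [hexPos_of_coord N _ _ _ r0 r1]; split_ifs <;> omega
  · obtain ⟨-, -, -, -, r0, r1, -⟩ := rot_apply_formula ![(N : ℤ), y]
    simp only [Matrix.cons_val_zero, Matrix.cons_val_one] at r0 r1
    rw [hexPos_of_coord N _ _ _ r0 r1]; split_ifs <;> omega
  · obtain ⟨-, -, -, -, -, -, r0, r1, -⟩ := rot_apply_formula ![(N : ℤ), y]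
    simp only [Matrix.cons_val_zero, Matrix.cons_val_one] at r0 r1
    rw [hexPos_of_coord N _ _ _ r0 r1]; split_ifs <;> omega
  · obtain ⟨-, -, -, -, -, -, -, -, r0, r1, -⟩ := rot_apply_formula ![(N : ℤ), y]
    simp only [Matrix.cons_val_zero, Matrix.cons_val_one] at r0 r1
    rw [hexPos_of_coord N _ _ _ r0 r1]; split_ifs <;> omega
  · obtain ⟨-, -, -, -, -, -, -, -, -, -, r0, r1⟩ := rot_apply_formula ![(N : ℤ), y]
    simp only [Matrix.cons_val_zero, Matrix.cons_val_one] at r0 r1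
    rw [hexPos_of_coord N _ _ _ r0 r1]; split_ifs <;> omega

/-- The first corner has perimeter coordinate `0`. [folklore] -/
theorem hexPos_corner (N : ℕ) (hN : 1 ≤ N) : hexPos N ![(N : ℤ), -(N : ℤ)] = 0 := by
  have := hexPos_rot_side0 (N := N) (i := 0) (by norm_num) (y := -(N : ℤ)) le_rfl (by omega)
  simpa using this

/-- The rotation carries the first corner of `∂Λ_N` to the second one. [folklore] -/
theorem triRot60_corner (N : ℕ) : triRot60 ![(N : ℤ), -(N : ℤ)] = ![(N : ℤ), 0] := by
  ext i
  fin_cases i <;> simp [triRot60_apply_zero, triRot60_apply_one]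

/-! ### Explicit points: membership in `Λ_N`, apexes -/

/-- A point with given coordinates lies in `Λ_N`. [folklore] -/
theorem mem_triBall_of_coord {N : ℕ} {a b : ℤ}
    (h : a ≤ N ∧ -a ≤ N ∧ b ≤ N ∧ -b ≤ N ∧ a + b ≤ N ∧ -(a + b) ≤ N) : ![a, b] ∈ triBall N := by
  rw [mem_triBall_iff, triNorm_le_iff_lin]
  simpa using h

/-- A point with given coordinates lies outside `Λ_N`. [folklore] -/
theorem not_mem_triBall_of_coord {N : ℕ} {a b : ℤ}
    (h : (N : ℤ) < a ∨ (N : ℤ) < -a ∨ (N : ℤ) < b ∨ (N : ℤ) < -b ∨ (N : ℤ) < a + b ∨ (N : ℤ) < -(a + b)) :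
    ![a, b] ∉ triBall N := by
  rw [mem_triBall_iff, not_le, lt_triNorm_iff_lin]
  simpa using h

/-- The norm of a point of the (closed) right side. [folklore] -/
theorem triNorm_side0 {K : ℕ} {t : ℤ} (ht : -(K : ℤ) ≤ t) (ht0 : t ≤ 0) : triNorm ![(K : ℤ), t] = K := by
  apply le_antisymm
  · rw [triNorm_le_iff_lin]; simp; omega
  · rw [le_triNorm_iff_lin]; simp

/-- The left apex in coordinates. [folklore] -/
theorem triLeftApex_of_coord (u v : Site 2) :
    triLeftApex u v = ![u 0 - (v 1 - u 1), u 1 + ((v 0 - u 0) + (v 1 - u 1))] := by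
  ext j
  fin_cases j
  · simp [triLeftApex, triRot60_apply_zero]; ring
  · simp [triLeftApex, triRot60_apply_one]

/-- The left apex of a dart between explicit points. [folklore] -/
theorem triLeftApex_vec (a b c d : ℤ) :
    triLeftApex ![a, b] ![c, d] = ![a - (d - b), b + ((c - a) + (d - b))] := by
  rw [triLeftApex_of_coord]; rfl

/-- Equality of explicit points from equality of coordinates. [folklore] -/
theorem vec2_eq {a b c d : ℤ} (h1 : a = c) (h2 : b = d) : (![a, b] : Site 2) = ![c, d] := by
  rw [h1, h2]

/-! ### Every site of the sphere is a rotated point of the half-open right side -/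

/-- **Parametrisation of `∂Λ_N`**: every site of graph norm `N ≥ 1` is `ρ^i (N, y)` with `i < 6`,
`-N ≤ y < 0`. [folklore] -/
theorem exists_rot_side0 {N : ℕ} (hN : 1 ≤ N) {u : Site 2} (hu : triNorm u = N) :
    ∃ i < 6, ∃ y : ℤ, -(N : ℤ) ≤ y ∧ y < 0 ∧ u = triRotIsoPow i ![(N : ℤ), y] := by
  obtain ⟨i, hi, hi0⟩ := exists_rot_symm_apply_zero_eq u
  set u₀ := (triRotIsoPow i).symm u with hu₀
  have hn : triNorm u₀ = N := by rw [hu₀, triNorm_rot_symm, hu]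
  have h0 : u₀ 0 = N := by rw [hi0, hu]
  have hle := triNorm_le_iff_lin.1 hn.le
  have hy1 : -(N : ℤ) ≤ u₀ 1 := by omega
  have hy2 : u₀ 1 ≤ 0 := by omega
  have hu' : u = triRotIsoPow i u₀ := by rw [hu₀, RelIso.apply_symm_apply]
  have hu₀eq : u₀ = ![(N : ℤ), u₀ 1] := by
    ext j; fin_cases j
    · simpa using h0
    · simp
  rcases lt_or_eq_of_le hy2 with hlt | heq
  · refine ⟨i, hi, u₀ 1, hy1, hlt, ?_⟩
    rw [← hu₀eq]; exact hu'
  · -- the last corner of side `i` is the first corner of side `i + 1`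
    have hc : u₀ = triRot60 ![(N : ℤ), -(N : ℤ)] := by rw [triRot60_corner, hu₀eq, heq]
    have hu'' : u = triRotIsoPow (i + 1) ![(N : ℤ), -(N : ℤ)] := by
      rw [triRotIsoPow_succ_apply', ← hc, hu']
    by_cases h6 : i + 1 < 6
    · exact ⟨i + 1, h6, -(N : ℤ), le_rfl, by omega, hu''⟩
    · have : i + 1 = 6 := by omega
      rw [this, triRotIsoPow_six_apply] at hu''
      exact ⟨0, by norm_num, -(N : ℤ), le_rfl, by omega, by rw [hu'', triRotIsoPow_zero_apply]⟩

/-- **The outward darts of the right side.** From `u = (N, y)`, `-N ≤ y < 0`, the neighbours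
outside `Λ_N` are `(N+1, y)`, `(N+1, y-1)` and, at the corner `y = -N` only, `(N, y-1)`. [folklore] -/
theorem side0_out_cases {N : ℕ} {y : ℤ} (hy : -(N : ℤ) ≤ y) (hy0 : y < 0) {v : Site 2}
    (hadj : triGraph.Adj ![(N : ℤ), y] v) (hv : v ∉ triBall N) :
    v = ![(N : ℤ) + 1, y] ∨ v = ![(N : ℤ) + 1, y - 1] ∨ (y = -(N : ℤ) ∧ v = ![(N : ℤ), y - 1]) := by
  rw [mem_triBall_iff, not_le] at hv
  have hvlin := lt_triNorm_iff_lin.1 hv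
  have key : ∀ a b : ℤ, v 0 = a → v 1 = b → v = ![a, b] := by
    intro a b ha hb; ext j; fin_cases j
    · simpa using ha
    · simpa using hb
  have hadj' := (triGraph_adj_iff_coord _ _).1 hadj
  simp only [Matrix.cons_val_zero, Matrix.cons_val_one] at hadj'
  rcases hadj' with h | h | h | h | h | h
  · exact Or.inl (key _ _ (by omega) (by omega))
  · exfalso; omega
  · exfalso; omega
  · by_cases hc : y = -(N : ℤ)
    · exact Or.inr (Or.inr ⟨hc, key _ _ (by omega) (by omega)⟩)
    · exfalso; omega
  · exact Or.inr (Or.inl (key _ _ (by omega) (by omega)))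
  · exfalso; omega

/-! ### The closing dart, the base dart, and the local monotonicity of the perimeter coordinate -/

/-- The first corner `(N, -N)` of `∂Λ_N`. [folklore] -/
def ballCorner (N : ℕ) : Site 2 := ![(N : ℤ), -(N : ℤ)]

/-- **The closing dart** `(N, -N) → (N, -N-1)`: the last boundary dart of `Λ_N` before the
traversal returns to the base dart. [folklore] -/
def ballCloseDart (N : ℕ) : Site 2 × Site 2 := (ballCorner N, ![(N : ℤ), -(N : ℤ) - 1])

/-- **The base dart** `(N, -N) → (N+1, -N-1)` of the traversal of `∂Λ_N`. [folklore] -/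
def ballBaseDart (N : ℕ) : Site 2 × Site 2 := (ballCorner N, ![(N : ℤ) + 1, -(N : ℤ) - 1])

/-- The base dart is a boundary dart of `Λ_N`. [folklore] -/
theorem ballBaseDart_mem (N : ℕ) : ballBaseDart N ∈ triBdryDarts (triBall N) := by
  rw [mem_triBdryDarts]
  refine ⟨mem_triBall_of_coord (by omega), not_mem_triBall_of_coord (by omega), ?_⟩
  show triGraph.Adj ![(N : ℤ), -(N : ℤ)] ![(N : ℤ) + 1, -(N : ℤ) - 1]
  rw [triGraph_adj_iff_coord]
  exact Or.inr (Or.inr (Or.inr (Or.inr (Or.inl ⟨rfl, by show (-(N : ℤ)) = -(N : ℤ) - 1 + 1; ring⟩))))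

/-- The closing dart is a boundary dart of `Λ_N`. [folklore] -/
theorem ballCloseDart_mem (N : ℕ) : ballCloseDart N ∈ triBdryDarts (triBall N) := by
  rw [mem_triBdryDarts]
  refine ⟨mem_triBall_of_coord (by omega), not_mem_triBall_of_coord (by omega), ?_⟩
  show triGraph.Adj ![(N : ℤ), -(N : ℤ)] ![(N : ℤ), -(N : ℤ) - 1]
  rw [triGraph_adj_iff_coord]
  exact Or.inr (Or.inr (Or.inr (Or.inl ⟨by show (-(N : ℤ)) = -(N : ℤ) - 1 + 1; ring, rfl⟩)))

/-- **The closing dart is followed by the base dart.** [folklore] -/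
theorem triBdrySucc_ballCloseDart (N : ℕ) : triBdrySucc (triBall N) (ballCloseDart N) = ballBaseDart N := by
  have hapex : triLeftApex ![(N : ℤ), -(N : ℤ)] ![(N : ℤ), -(N : ℤ) - 1] = ![(N : ℤ) + 1, -(N : ℤ) - 1] := by
    rw [triLeftApex_vec]; exact vec2_eq (by ring) (by ring)
  unfold triBdrySucc ballCloseDart ballBaseDart ballCorner
  dsimp only
  rw [hapex, if_neg (not_mem_triBall_of_coord (by omega))]

/-- The tail of a boundary dart of `Λ_N` lies on `∂Λ_N`. [folklore] -/
theorem triNorm_fst_of_mem_triBdryDarts {N : ℕ} {d : Site 2 × Site 2} (hd : d ∈ triBdryDarts (triBall N)) :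
    triNorm d.1 = N := by
  obtain ⟨h1, h2, hadj⟩ := mem_triBdryDarts.1 hd
  rw [mem_triBall_iff] at h1 h2
  have := triNorm_le_triNorm_add_one_of_adj hadj
  omega

/-- **Local monotonicity of the perimeter coordinate along the traversal of `∂Λ_N`** (`N ≥ 1`):
for every boundary dart `d`, the tail of its successor has the same perimeter coordinate, or the
next one, or the successor is the closing dart `(N,-N) → (N,-N-1)` (where the coordinate wraps
from `6N - 1` to `0`). By rotation covariance (`triBdrySucc_rot`) it suffices to treat tails on the
half-open right side, whose outward darts are listed by `side0_out_cases`. [folklore] -/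
theorem hexPos_fst_triBdrySucc {N : ℕ} (hN : 1 ≤ N) {d : Site 2 × Site 2} (hd : d ∈ triBdryDarts (triBall N)) :
    hexPos N (triBdrySucc (triBall N) d).1 = hexPos N d.1 ∨
      hexPos N (triBdrySucc (triBall N) d).1 = hexPos N d.1 + 1 ∨
      triBdrySucc (triBall N) d = ballCloseDart N := by
  obtain ⟨-, hd2, hadj⟩ := mem_triBdryDarts.1 hd
  obtain ⟨i, hi, y, hy, hy0, hu⟩ := exists_rot_side0 hN (triNorm_fst_of_mem_triBdryDarts hd)
  set v₀ := (triRotIsoPow i).symm d.2 with hv₀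
  have hv : d.2 = triRotIsoPow i v₀ := by rw [hv₀, RelIso.apply_symm_apply]
  have hadj₀ : triGraph.Adj ![(N : ℤ), y] v₀ := by
    have h' := hadj
    rw [hu, hv] at h'
    exact (rot_adj_iff i).1 h'
  have hv₀out : v₀ ∉ triBall N := by rw [← rot_mem_triBall_iff i, ← hv]; exact hd2
  have hd' : d = (triRotIsoPow i ![(N : ℤ), y], triRotIsoPow i v₀) := Prod.ext hu hv
  rw [hd', triBdrySucc_rot]
  dsimp only
  rcases side0_out_cases hy hy0 hadj₀ hv₀out with e | e | ⟨hc, e⟩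
  · -- the dart `(N, y) → (N+1, y)`: the traversal steps to `(N, y+1)`
    rw [e]
    have hapex : triLeftApex ![(N : ℤ), y] ![(N : ℤ) + 1, y] = ![(N : ℤ), y + 1] := by
      rw [triLeftApex_vec]; exact vec2_eq (by ring) (by ring)
    have hin : ![(N : ℤ), y + 1] ∈ triBall N := mem_triBall_of_coord (by omega)
    have hsucc : triBdrySucc (triBall N) (![(N : ℤ), y], ![(N : ℤ) + 1, y]) = (![(N : ℤ), y + 1], ![(N : ℤ) + 1, y]) := by
      unfold triBdrySucc; dsimp only; rw [hapex, if_pos hin]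
    rw [hsucc]
    dsimp only
    rcases lt_or_eq_of_le (show y + 1 ≤ 0 by omega) with hlt | heq
    · right; left
      rw [hexPos_rot_side0 hi hy hy0, hexPos_rot_side0 hi (by omega) hlt]; ring
    · have hy1 : y = -1 := by omega
      subst hy1
      have hcor : ![(N : ℤ), -1 + 1] = triRot60 ![(N : ℤ), -(N : ℤ)] := by
        rw [triRot60_corner]; norm_num
      by_cases h5 : i + 1 < 6
      · right; left
        rw [hexPos_rot_side0 hi hy hy0, hcor, ← triRotIsoPow_succ_apply',
          hexPos_rot_side0 h5 le_rfl (by omega)]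
        push_cast; ring
      · -- side `5`: the traversal reaches the closing dart
        right; right
        have hi5 : i = 5 := by omega
        subst hi5
        obtain ⟨-, -, -, -, -, -, -, -, -, -, r50, r51⟩ := rot_apply_formula ![(N : ℤ) + 1, (-1 : ℤ)]
        simp only [Matrix.cons_val_zero, Matrix.cons_val_one] at r50 r51
        refine Prod.ext ?_ ?_
        · show triRotIsoPow 5 ![(N : ℤ), -1 + 1] = ballCorner N
          rw [hcor, ← triRotIsoPow_succ_apply', triRotIsoPow_six_apply]; rfl
        · show triRotIsoPow 5 ![(N : ℤ) + 1, -1] = ![(N : ℤ), -(N : ℤ) - 1]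
          ext j; fin_cases j
          · simp [r50]
          · simp [r51]; ring
  · -- the dart `(N, y) → (N+1, y-1)`: the traversal turns about `(N, y)`
    rw [e]
    have hapex : triLeftApex ![(N : ℤ), y] ![(N : ℤ) + 1, y - 1] = ![(N : ℤ) + 1, y] := by
      rw [triLeftApex_vec]; exact vec2_eq (by ring) (by ring)
    have hout : ![(N : ℤ) + 1, y] ∉ triBall N := not_mem_triBall_of_coord (by omega)
    have hsucc : triBdrySucc (triBall N) (![(N : ℤ), y], ![(N : ℤ) + 1, y - 1]) = (![(N : ℤ), y], ![(N : ℤ) + 1, y]) := by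
      unfold triBdrySucc; dsimp only; rw [hapex, if_neg hout]
    rw [hsucc]
    left; rfl
  · -- the corner dart `(N, -N) → (N, -N-1)`: the traversal turns about the corner
    rw [e]
    subst hc
    have hapex : triLeftApex ![(N : ℤ), -(N : ℤ)] ![(N : ℤ), -(N : ℤ) - 1] = ![(N : ℤ) + 1, -(N : ℤ) - 1] := by
      rw [triLeftApex_vec]; exact vec2_eq (by ring) (by ring)
    have hout : ![(N : ℤ) + 1, -(N : ℤ) - 1] ∉ triBall N := not_mem_triBall_of_coord (by omega)
    have hsucc : triBdrySucc (triBall N) (![(N : ℤ), -(N : ℤ)], ![(N : ℤ), -(N : ℤ) - 1]) =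
        (![(N : ℤ), -(N : ℤ)], ![(N : ℤ) + 1, -(N : ℤ) - 1]) := by
      unfold triBdrySucc; dsimp only; rw [hapex, if_neg hout]
    rw [hsucc]
    left; rfl

/-! ### `Λ_N` is a disc -/

/-- **Every site has a neighbour of graph norm one more** (step outward in the sector of the
site). [folklore] -/
theorem exists_adj_triNorm_eq_add_one (z : Site 2) :
    ∃ z' : Site 2, triGraph.Adj z z' ∧ triNorm z' = triNorm z + 1 := by
  set n := triNorm z with hn
  have mk : ∀ z' : Site 2, triGraph.Adj z z' → n + 1 ≤ triNorm z' →
      ∃ z' : Site 2, triGraph.Adj z z' ∧ triNorm z' = triNorm z + 1 := by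
    intro z' ha hb
    refine ⟨z', ha, le_antisymm ?_ (by rw [← hn]; exact hb)⟩
    have := triNorm_le_triNorm_add_one_of_adj ha
    rw [← hn] at this ⊢; exact this
  have adj : ∀ a b : ℤ, ((a = z 0 + 1 ∧ b = z 1) ∨ (z 0 = a + 1 ∧ b = z 1) ∨
      (b = z 1 + 1 ∧ a = z 0) ∨ (z 1 = b + 1 ∧ a = z 0) ∨
      (a = z 0 + 1 ∧ z 1 = b + 1) ∨ (z 0 = a + 1 ∧ b = z 1 + 1)) → triGraph.Adj z ![a, b] := by
    intro a b h
    rw [triGraph_adj_iff_coord]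
    simpa only [Matrix.cons_val_zero, Matrix.cons_val_one] using h
  have nge : ∀ a b : ℤ, (n + 1 ≤ a ∨ n + 1 ≤ -a ∨ n + 1 ≤ b ∨ n + 1 ≤ -b ∨ n + 1 ≤ a + b ∨ n + 1 ≤ -(a + b)) →
      n + 1 ≤ triNorm ![a, b] := by
    intro a b h
    rw [le_triNorm_iff_lin]
    simpa only [Matrix.cons_val_zero, Matrix.cons_val_one] using h
  rcases le_triNorm_iff_lin.1 (le_refl n) with h | h | h | h | h | h
  · exact mk _ (adj (z 0 + 1) (z 1) (by omega)) (nge _ _ (by omega))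
  · exact mk _ (adj (z 0 - 1) (z 1) (by omega)) (nge _ _ (by omega))
  · exact mk _ (adj (z 0) (z 1 + 1) (by omega)) (nge _ _ (by omega))
  · exact mk _ (adj (z 0) (z 1 - 1) (by omega)) (nge _ _ (by omega))
  · exact mk _ (adj (z 0 + 1) (z 1) (by omega)) (nge _ _ (by omega))
  · exact mk _ (adj (z 0 - 1) (z 1) (by omega)) (nge _ _ (by omega))

/-- **Radial paths outward**: from any site `z` to the sphere of any larger radius `K`, through
sites of norm at least `|z|`. [folklore] -/
theorem exists_pathIn_outward (z : Site 2) (K : ℕ) (hK : triNorm z ≤ K) :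
    ∃ w : Site 2, triNorm w = K ∧ PathIn triGraph {v : Site 2 | triNorm z ≤ triNorm v} z w := by
  suffices H : ∀ (m : ℕ) (z' : Site 2), triNorm z ≤ triNorm z' → triNorm z' + m = K →
      ∃ w : Site 2, triNorm w = K ∧ PathIn triGraph {v : Site 2 | triNorm z ≤ triNorm v} z' w by
    have h0 := triNorm_nonneg z
    exact H (K - triNorm z).toNat z le_rfl (by omega)
  intro m
  induction m with
  | zero =>
    intro z' hz' h
    exact ⟨z', by omega, PathIn.refl hz'⟩
  | succ m ih =>
    intro z' hz' h
    obtain ⟨z'', hadj, hn⟩ := exists_adj_triNorm_eq_add_one z'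
    obtain ⟨w, hw, hp⟩ := ih z'' (by rw [hn]; omega) (by rw [hn]; omega)
    have hz'' : z'' ∈ {v : Site 2 | triNorm z ≤ triNorm v} := by
      show triNorm z ≤ triNorm z''; rw [hn]; omega
    exact ⟨w, hw, (PathIn.of_adj (A := {v : Site 2 | triNorm z ≤ triNorm v}) hz' hz'' hadj).trans hp⟩

/-- Along the half-open side `i` of `∂Λ_K`: from `ρ^i (K, y)` to the next corner `ρ^i (K, 0)`
inside the sphere. [folklore] -/
theorem pathIn_triSphere_side {K : ℕ} (i : ℕ) {y : ℤ} (hy : -(K : ℤ) ≤ y) (hy0 : y ≤ 0) :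
    PathIn triGraph {v : Site 2 | triNorm v = K} (triRotIsoPow i ![(K : ℤ), y]) (triRotIsoPow i ![(K : ℤ), 0]) := by
  suffices H : ∀ (m : ℕ) (t : ℤ), -(K : ℤ) ≤ t → t + m = 0 →
      PathIn triGraph {v : Site 2 | triNorm v = K} (triRotIsoPow i ![(K : ℤ), t]) (triRotIsoPow i ![(K : ℤ), 0]) by
    exact H (-y).toNat y hy (by omega)
  intro m
  induction m with
  | zero =>
    intro t ht h
    have : t = 0 := by omega
    subst this
    exact PathIn.refl (show triNorm _ = _ by rw [triNorm_rot, triNorm_side0 (by omega) le_rfl])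
  | succ m ih =>
    intro t ht h
    have hadj : triGraph.Adj (triRotIsoPow i ![(K : ℤ), t]) (triRotIsoPow i ![(K : ℤ), t + 1]) := by
      rw [rot_adj_iff, triGraph_adj_iff_coord]
      exact Or.inr (Or.inr (Or.inl ⟨rfl, rfl⟩))
    have h1 : triRotIsoPow i ![(K : ℤ), t] ∈ {v : Site 2 | triNorm v = K} := by
      show triNorm _ = _; rw [triNorm_rot, triNorm_side0 ht (by omega)]
    have h2 : triRotIsoPow i ![(K : ℤ), t + 1] ∈ {v : Site 2 | triNorm v = K} := by
      show triNorm _ = _; rw [triNorm_rot, triNorm_side0 (by omega) (by omega)]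
    exact (PathIn.of_adj h1 h2 hadj).trans (ih (t + 1) (by omega) (by omega))

/-- From the `j`-th corner of `∂Λ_K` (`j ≤ 6`) back to the first one inside the sphere. [folklore] -/
theorem pathIn_triSphere_corner_to_base {K : ℕ} (hK : 1 ≤ K) :
    ∀ j ≤ 6, PathIn triGraph {v : Site 2 | triNorm v = K} (triRotIsoPow j ![(K : ℤ), -(K : ℤ)]) ![(K : ℤ), -(K : ℤ)] := by
  suffices H : ∀ m : ℕ, ∀ j ≤ 6, 6 - j = m →
      PathIn triGraph {v : Site 2 | triNorm v = K} (triRotIsoPow j ![(K : ℤ), -(K : ℤ)]) ![(K : ℤ), -(K : ℤ)] by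
    exact fun j hj => H (6 - j) j hj rfl
  intro m
  induction m with
  | zero =>
    intro j hj h
    have : j = 6 := by omega
    subst this
    rw [triRotIsoPow_six_apply]
    exact PathIn.refl (show triNorm _ = _ from triNorm_side0 le_rfl (by omega))
  | succ m ih =>
    intro j hj h
    have hj6 : j < 6 := by omega
    -- along side `j` to its last corner, which is the first corner of side `j + 1`
    have h1 := pathIn_triSphere_side (K := K) j (y := -(K : ℤ)) le_rfl (by omega)
    rw [show (![(K : ℤ), 0] : Site 2) = triRot60 ![(K : ℤ), -(K : ℤ)] from (triRot60_corner K).symm,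
      ← triRotIsoPow_succ_apply'] at h1
    exact h1.trans (ih (j + 1) (by omega) (by omega))

/-- **The spheres `∂Λ_K` are connected** (`K ≥ 1`): any two sites of norm `K` are joined through
sites of norm `K`. [folklore] -/
theorem pathIn_triSphere {K : ℕ} (hK : 1 ≤ K) {u u' : Site 2} (hu : triNorm u = K) (hu' : triNorm u' = K) :
    PathIn triGraph {v : Site 2 | triNorm v = K} u u' := by
  have toBase : ∀ w : Site 2, triNorm w = K → PathIn triGraph {v : Site 2 | triNorm v = K} w ![(K : ℤ), -(K : ℤ)] := by
    intro w hw
    obtain ⟨i, hi, y, hy, hy0, rfl⟩ := exists_rot_side0 hK hw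
    have h1 := pathIn_triSphere_side (K := K) i hy hy0.le
    rw [show (![(K : ℤ), 0] : Site 2) = triRot60 ![(K : ℤ), -(K : ℤ)] from (triRot60_corner K).symm,
      ← triRotIsoPow_succ_apply'] at h1
    exact h1.trans (pathIn_triSphere_corner_to_base hK (i + 1) (by omega))
  exact (toBase u hu).trans (toBase u' hu').symm

/-- **The complement of `Λ_N` is connected**: two sites outside are joined outside (radially out to
a large sphere, then around it). [folklore] -/
theorem triBall_coconnected (N : ℕ) :
    ∀ o ∉ triBall N, ∀ o' ∉ triBall N, PathIn triGraph (↑(triBall N) : Set (Site 2))ᶜ o o' := by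
  intro o ho o' ho'
  rw [mem_triBall_iff, not_le] at ho ho'
  have h0 := triNorm_nonneg o
  have h0' := triNorm_nonneg o'
  set K : ℕ := (triNorm o + triNorm o').toNat with hK
  obtain ⟨w, hw, hp⟩ := exists_pathIn_outward o K (by omega)
  obtain ⟨w', hw', hp'⟩ := exists_pathIn_outward o' K (by omega)
  have hK1 : 1 ≤ K := by omega
  have hs := pathIn_triSphere hK1 hw hw'
  have out : ∀ v : Site 2, (N : ℤ) < triNorm v → v ∈ (↑(triBall N) : Set (Site 2))ᶜ := fun v hv => by
    simp only [Set.mem_compl_iff, Finset.mem_coe, mem_triBall_iff, not_le]; exact hv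
  refine ((hp.mono fun v hv => out v (lt_of_lt_of_le ho hv)).trans
    (hs.mono fun v hv => out v ?_)).trans (hp'.mono fun v hv => out v (lt_of_lt_of_le ho' hv)).symm
  have hv' : triNorm v = K := hv
  omega

/-- **`Λ_N` is a disc**, based at the dart `(N, -N) → (N+1, -N-1)` (`exists_isTriDisc_of_coconnected`
with `pathIn_triBall` and `triBall_coconnected`, then `rebase`). [cite: BollobasRiordan2006, Ch. 7 §7.2.2 p. 168] -/
theorem isTriDisc_triBall (N : ℕ) : IsTriDisc (triBall N) (ballBaseDart N) := by
  obtain ⟨b, hb⟩ := exists_isTriDisc_of_coconnected _ (triBall N) rfl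
    ⟨0, mem_triBall_iff.2 (by rw [triNorm_zero]; exact_mod_cast Nat.zero_le N)⟩
    (fun p hp q hq => pathIn_triBall (mem_triBall_iff.1 hp) (mem_triBall_iff.1 hq))
    (triBall_coconnected N)
  exact hb.rebase (ballBaseDart_mem N)

/-! ### Monotonicity of the perimeter coordinate along a period, and the interleaving theorem -/

/-- **The closing dart sits at the last position of the period** (its successor is the base). [folklore] -/
theorem triBdryIter_card_sub_one {N : ℕ} :
    2 ≤ #(triBdryDarts (triBall N)) ∧
      triBdryIter (triBall N) (ballBaseDart N) (#(triBdryDarts (triBall N)) - 1) = ballCloseDart N := by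
  have h := isTriDisc_triBall N
  obtain ⟨q, hq, hqd⟩ := h.cycle _ (ballCloseDart_mem N)
  have e : triBdryIter (triBall N) (ballBaseDart N) (q + 1) = triBdryIter (triBall N) (ballBaseDart N) 0 := by
    rw [triBdryIter_succ, hqd, triBdrySucc_ballCloseDart, triBdryIter_zero]
  have hmod := (h.iter_eq_iter_iff).1 e
  rw [Nat.zero_mod] at hmod
  have hq1 : q + 1 = #(triBdryDarts (triBall N)) := by
    rcases Nat.lt_or_ge (q + 1) #(triBdryDarts (triBall N)) with hlt | hge
    · rw [Nat.mod_eq_of_lt hlt] at hmod; omega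
    · omega
  have hne : ballCloseDart N ≠ ballBaseDart N := by
    intro h'
    have := congrArg (fun d : Site 2 × Site 2 => d.2 0) h'
    simp [ballCloseDart, ballBaseDart] at this
  refine ⟨?_, ?_⟩
  · by_contra hlt
    have hq0 : q = 0 := by omega
    rw [hq0, triBdryIter_zero] at hqd
    exact hne hqd.symm
  · rw [← hq1, Nat.add_sub_cancel]; exact hqd

/-- **The perimeter coordinate of the tail is non-decreasing along a period of the traversal of
`∂Λ_N`** (positions `0, …, #∂ - 2`; the last position `#∂ - 1` carries the closing dart, whose
tail is the first corner again). [folklore] -/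
theorem hexPos_iter_mono {N : ℕ} (hN : 1 ≤ N) {m n : ℕ} (hmn : m ≤ n) (hn : n + 2 ≤ #(triBdryDarts (triBall N))) :
    hexPos N (triBdryIter (triBall N) (ballBaseDart N) m).1 ≤
      hexPos N (triBdryIter (triBall N) (ballBaseDart N) n).1 := by
  have h := isTriDisc_triBall N
  obtain ⟨h2, hlast⟩ := triBdryIter_card_sub_one (N := N)
  have step : ∀ k, k + 3 ≤ #(triBdryDarts (triBall N)) →
      hexPos N (triBdryIter (triBall N) (ballBaseDart N) k).1 ≤
        hexPos N (triBdryIter (triBall N) (ballBaseDart N) (k + 1)).1 := by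
    intro k hk
    rw [triBdryIter_succ]
    rcases hexPos_fst_triBdrySucc hN (triBdryIter_mem (ballBaseDart_mem N) k) with e | e | e
    · rw [e]
    · rw [e]; exact (lt_add_one _).le
    · exfalso
      have e' : triBdryIter (triBall N) (ballBaseDart N) (k + 1) =
          triBdryIter (triBall N) (ballBaseDart N) (#(triBdryDarts (triBall N)) - 1) := by
        rw [triBdryIter_succ, e, hlast]
      have := (h.iter_eq_iter_iff).1 e'
      rw [Nat.mod_eq_of_lt (by omega), Nat.mod_eq_of_lt (by omega)] at this
      omega
  induction n, hmn using Nat.le_induction with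
  | base => exact le_rfl
  | succ n hmn ih => exact (ih (by omega)).trans (step n (by omega))

/-- Every site of `∂Λ_N` is the tail of the dart at some position `≤ #∂ - 2` of the traversal. [folklore] -/
theorem exists_pos_of_mem_sphere {N : ℕ} {u : Site 2} (hu : triNorm u = N) :
    ∃ n, n + 2 ≤ #(triBdryDarts (triBall N)) ∧ (triBdryIter (triBall N) (ballBaseDart N) n).1 = u := by
  have h := isTriDisc_triBall N
  obtain ⟨h2, hlast⟩ := triBdryIter_card_sub_one (N := N)
  obtain ⟨v, hadj, hv⟩ := exists_adj_triNorm_eq_add_one u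
  have hvout : v ∉ triBall N := by rw [mem_triBall_iff, not_le]; omega
  have hd : (u, v) ∈ triBdryDarts (triBall N) := mem_triBdryDarts.2 ⟨mem_triBall_iff.2 hu.le, hvout, hadj⟩
  obtain ⟨n, hn, hnd⟩ := h.cycle _ hd
  by_cases hn2 : n + 2 ≤ #(triBdryDarts (triBall N))
  · exact ⟨n, hn2, by rw [hnd]⟩
  · -- the closing dart: its tail is the corner, also the tail of the base dart at position `0`
    have hn1 : n = #(triBdryDarts (triBall N)) - 1 := by omega
    rw [hn1, hlast] at hnd
    refine ⟨0, by omega, ?_⟩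
    rw [triBdryIter_zero]
    have := congrArg Prod.fst hnd
    exact this

/-- **Interleaved paths of disjoint classes do not coexist in the hexagon `Λ_N`** (`N ≥ 1`;
Bollobás–Riordan 2006, Ch. 7, Lemma 5, "but not both", for the disc `Λ_N`): if `x, y, x', y'` are
sites of `∂Λ_N` with perimeter coordinates `hexPos x < hexPos y < hexPos x' < hexPos y'`, then for
NO set of sites `B` do there exist both a `𝕋`-path of sites of `Λ_N ∩ B` from `x` to `x'` and a
`𝕋`-path of sites of `Λ_N ∖ B` from `y` to `y'`. (The other interleaved order is the same statement
with `B` replaced by `Bᶜ`.) [cite: BollobasRiordan2006, Ch. 7 Lemma 5 p. 169] -/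
theorem triBall_not_interleaved {N : ℕ} (hN : 1 ≤ N) (B : Set (Site 2)) {x y x' y' : Site 2}
    (hx : triNorm x = N) (hy : triNorm y = N) (hx' : triNorm x' = N) (hy' : triNorm y' = N)
    (h₁ : hexPos N x < hexPos N y) (h₂ : hexPos N y < hexPos N x') (h₃ : hexPos N x' < hexPos N y')
    (hP : PathIn triGraph ((↑(triBall N) : Set (Site 2)) ∩ B) x x')
    (hQ : PathIn triGraph ((↑(triBall N) : Set (Site 2)) ∩ Bᶜ) y y') : False := by
  have h := isTriDisc_triBall N
  obtain ⟨nx, hnx, ex⟩ := exists_pos_of_mem_sphere hx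
  obtain ⟨ny, hny, ey⟩ := exists_pos_of_mem_sphere hy
  obtain ⟨nx', hnx', ex'⟩ := exists_pos_of_mem_sphere hx'
  obtain ⟨ny', hny', ey'⟩ := exists_pos_of_mem_sphere hy'
  have lt : ∀ {a b : ℕ}, a + 2 ≤ #(triBdryDarts (triBall N)) → b + 2 ≤ #(triBdryDarts (triBall N)) →
      hexPos N (triBdryIter (triBall N) (ballBaseDart N) a).1 < hexPos N (triBdryIter (triBall N) (ballBaseDart N) b).1 →
      a < b := by
    intro a b ha hb hab
    by_contra hle
    exact absurd (hexPos_iter_mono hN (not_lt.1 hle) ha) (not_le.2 hab)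
  have h12 : nx < ny := lt hnx hny (by rw [ex, ey]; exact h₁)
  have h23 : ny < nx' := lt hny hnx' (by rw [ey, ex']; exact h₂)
  have h34 : nx' < ny' := lt hnx' hny' (by rw [ex', ey']; exact h₃)
  refine h.not_interleaved B h12 h23 h34 (by omega) ?_ ?_
  · rw [ex, ex']; exact hP
  · rw [ey, ey']; exact hQ

/-! ### Injectivity and range of the perimeter coordinate; perimeter neighbours -/

/-- The perimeter coordinate of a site of `∂Λ_N` lies in `[0, 6N)`. [folklore] -/
theorem hexPos_range {N : ℕ} (hN : 1 ≤ N) {u : Site 2} (hu : triNorm u = N) :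
    0 ≤ hexPos N u ∧ hexPos N u < 6 * N := by
  obtain ⟨i, hi, y, hy, hy0, rfl⟩ := exists_rot_side0 hN hu
  rw [hexPos_rot_side0 hi hy hy0]
  have hi' : (i : ℤ) ≤ 5 := by exact_mod_cast Nat.le_of_lt_succ hi
  constructor <;> nlinarith

/-- **The perimeter coordinate is injective on `∂Λ_N`.** [folklore] -/
theorem hexPos_injOn {N : ℕ} (hN : 1 ≤ N) {u v : Site 2} (hu : triNorm u = N) (hv : triNorm v = N)
    (h : hexPos N u = hexPos N v) : u = v := by
  obtain ⟨i, hi, y, hy, hy0, rfl⟩ := exists_rot_side0 hN hu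
  obtain ⟨i', hi', y', hy', hy0', rfl⟩ := exists_rot_side0 hN hv
  rw [hexPos_rot_side0 hi hy hy0, hexPos_rot_side0 hi' hy' hy0'] at h
  have key : i = i' ∧ y = y' := by
    interval_cases i <;> interval_cases i' <;> constructor <;> omega
  obtain ⟨rfl, rfl⟩ := key
  rfl

/-- `R² - R + 1 = 0` for the rotation `R` by `60°`: the left apex of `u → v`, seen from `v`, has
`u` as ITS left apex over the reversed edge, i.e. `v + R(apex - v) = u`. [folklore] -/
theorem add_triRot60_triLeftApex_sub (u v : Site 2) : v + triRot60 (triLeftApex u v - v) = u := by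
  ext j
  fin_cases j <;> simp [triLeftApex, triRot60_apply_zero, triRot60_apply_one] <;> ring

/-- The unique common neighbour of the first corner `(N,-N)` and `(N,-N-1)` on `∂Λ_N` is
`(N-1, -N)`, of perimeter coordinate `6N - 1`. [folklore] -/
theorem eq_last_of_adj_corner {N : ℕ} {v : Site 2} (hv : triNorm v = N)
    (h1 : triGraph.Adj v ![(N : ℤ), -(N : ℤ)]) (h2 : triGraph.Adj v ![(N : ℤ), -(N : ℤ) - 1]) :
    hexPos N v = 6 * N - 1 := by
  have hvlin := triNorm_le_iff_lin.1 hv.le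
  have h1' := (triGraph_adj_iff_coord _ _).1 h1
  have h2' := (triGraph_adj_iff_coord _ _).1 h2
  simp only [Matrix.cons_val_zero, Matrix.cons_val_one] at h1' h2'
  have hc : v 0 = (N : ℤ) - 1 ∧ v 1 = -(N : ℤ) := by omega
  rw [hexPos_of_coord N v _ _ hc.1 hc.2]
  split_ifs <;> omega

/-- **The clockwise perimeter neighbour.** If `u, v ∈ ∂Λ_N` are adjacent and the left apex of the
dart `u → v` lies outside `Λ_N`, then `v` is the clockwise neighbour of `u` on the hexagon:
`hexPos v + 1 = hexPos u`, or `u` is the first corner (`hexPos u = 0`) and `hexPos v = 6N - 1`.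
(In the anticlockwise traversal of `∂Λ_N`, the dart `v → apex` is followed by `u → apex`.) [folklore] -/
theorem hexPos_of_leftApex_out {N : ℕ} (hN : 1 ≤ N) {u v : Site 2} (hu : triNorm u = N) (hv : triNorm v = N)
    (hadj : triGraph.Adj u v) (hout : triLeftApex u v ∉ triBall N) :
    hexPos N v + 1 = hexPos N u ∨ (hexPos N u = 0 ∧ hexPos N v = 6 * N - 1) := by
  set o := triLeftApex u v with ho
  have hvo : triGraph.Adj v o := (triGraph_adj_triLeftApex_right hadj).symm
  have hd : (v, o) ∈ triBdryDarts (triBall N) := mem_triBdryDarts.2 ⟨mem_triBall_iff.2 hv.le, hout, hvo⟩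
  have hapex : triLeftApex v o = u := add_triRot60_triLeftApex_sub u v
  have hsucc : triBdrySucc (triBall N) (v, o) = (u, o) := by
    unfold triBdrySucc; dsimp only; rw [hapex, if_pos (mem_triBall_iff.2 hu.le)]
  rcases hexPos_fst_triBdrySucc hN hd with e | e | e
  · rw [hsucc] at e
    exact absurd (hexPos_injOn hN hu hv e) hadj.ne
  · rw [hsucc] at e; exact Or.inl e.symm
  · rw [hsucc] at e
    have hu' : u = ![(N : ℤ), -(N : ℤ)] := congrArg Prod.fst e
    have ho' : o = ![(N : ℤ), -(N : ℤ) - 1] := congrArg Prod.snd e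
    refine Or.inr ⟨?_, eq_last_of_adj_corner hv (hu' ▸ hadj.symm) (ho' ▸ hvo)⟩
    rw [hu']; exact hexPos_corner N hN

/-- **The anticlockwise perimeter neighbour.** If `u ∈ ∂Λ_N`, `o ∉ Λ_N` are adjacent and the left
apex `a` of the dart `u → o` lies in `Λ_N`, then `a ∈ ∂Λ_N` is the anticlockwise neighbour of `u`:
`hexPos a = hexPos u + 1`, or `a` is the first corner (`hexPos a = 0`) and `hexPos u = 6N - 1`. [folklore] -/
theorem hexPos_of_leftApex_in {N : ℕ} (hN : 1 ≤ N) {u o : Site 2} (hu : triNorm u = N) (ho : (N : ℤ) < triNorm o)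
    (hadj : triGraph.Adj u o) (hin : triLeftApex u o ∈ triBall N) :
    triNorm (triLeftApex u o) = N ∧
      (hexPos N (triLeftApex u o) = hexPos N u + 1 ∨ (hexPos N (triLeftApex u o) = 0 ∧ hexPos N u = 6 * N - 1)) := by
  set a := triLeftApex u o with ha
  have hao : triGraph.Adj a o := triGraph_adj_triLeftApex_right hadj
  have han : triNorm a = N := by
    have h1 := mem_triBall_iff.1 hin
    have h2 := triNorm_le_triNorm_add_one_of_adj hao
    omega
  refine ⟨han, ?_⟩
  have hd : (u, o) ∈ triBdryDarts (triBall N) :=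
    mem_triBdryDarts.2 ⟨mem_triBall_iff.2 hu.le, by rw [mem_triBall_iff, not_le]; exact ho, hadj⟩
  have hsucc : triBdrySucc (triBall N) (u, o) = (a, o) := by
    unfold triBdrySucc; dsimp only; rw [← ha, if_pos hin]
  rcases hexPos_fst_triBdrySucc hN hd with e | e | e
  · rw [hsucc] at e
    exact absurd (hexPos_injOn hN han hu e) (triGraph_adj_triLeftApex_left hadj).ne.symm
  · rw [hsucc] at e; exact Or.inl e
  · rw [hsucc] at e
    have ha' : a = ![(N : ℤ), -(N : ℤ)] := congrArg Prod.fst e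
    have ho' : o = ![(N : ℤ), -(N : ℤ) - 1] := congrArg Prod.snd e
    refine Or.inr ⟨by rw [ha']; exact hexPos_corner N hN, ?_⟩
    exact eq_last_of_adj_corner hu (ha' ▸ triGraph_adj_triLeftApex_left hadj) (ho' ▸ hadj)

/-! ### The perimeter coordinate from a moving origin -/

/-- **The perimeter coordinate shifted to start at `r ∈ ∂Λ_N`**: anticlockwise distance from `r`,
in `[0, 6N)`. [folklore] -/
def hexShift (N : ℕ) (r v : Site 2) : ℤ :=
  if hexPos N r ≤ hexPos N v then hexPos N v - hexPos N r else hexPos N v - hexPos N r + 6 * N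

/-- The origin has shifted coordinate `0`. [folklore] -/
theorem hexShift_self (N : ℕ) (r : Site 2) : hexShift N r r = 0 := by
  simp [hexShift]

/-- The shifted coordinate lies in `[0, 6N)`. [folklore] -/
theorem hexShift_range {N : ℕ} (hN : 1 ≤ N) {r v : Site 2} (hr : triNorm r = N) (hv : triNorm v = N) :
    0 ≤ hexShift N r v ∧ hexShift N r v < 6 * N := by
  have h1 := hexPos_range hN hr
  have h2 := hexPos_range hN hv
  unfold hexShift; split_ifs <;> omega

/-- The shifted coordinate is injective on `∂Λ_N`. [folklore] -/
theorem hexShift_injOn {N : ℕ} (hN : 1 ≤ N) {r u v : Site 2} (hu : triNorm u = N) (hv : triNorm v = N)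
    (h : hexShift N r u = hexShift N r v) : u = v := by
  have h1 := hexPos_range hN hu
  have h2 := hexPos_range hN hv
  refine hexPos_injOn hN hu hv ?_
  unfold hexShift at h; split_ifs at h <;> omega

/-- The cyclic predecessor of the origin has shifted coordinate `6N - 1`. [folklore] -/
theorem hexShift_eq_last {N : ℕ} (hN : 1 ≤ N) {r v : Site 2} (hr : triNorm r = N) (hv : triNorm v = N)
    (h : hexPos N v + 1 = hexPos N r ∨ (hexPos N r = 0 ∧ hexPos N v = 6 * N - 1)) :
    hexShift N r v = 6 * N - 1 := by
  have h1 := hexPos_range hN hr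
  have h2 := hexPos_range hN hv
  unfold hexShift; split_ifs <;> omega

/-- A cyclic successor stays a successor in the shifted coordinate, unless it is the origin. [folklore] -/
theorem hexShift_eq_add_one {N : ℕ} (hN : 1 ≤ N) {r u a : Site 2} (hr : triNorm r = N) (hu : triNorm u = N)
    (ha : triNorm a = N)
    (h : hexPos N a = hexPos N u + 1 ∨ (hexPos N a = 0 ∧ hexPos N u = 6 * N - 1)) (hne : a ≠ r) :
    hexShift N r a = hexShift N r u + 1 := by
  have h1 := hexPos_range hN hr
  have h2 := hexPos_range hN hu
  have h3 := hexPos_range hN ha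
  have hne' : hexPos N a ≠ hexPos N r := fun e => hne (hexPos_injOn hN ha hr e)
  unfold hexShift; split_ifs <;> omega

/-- **Interleaving in the shifted coordinate is impossible as well**: for sites `a, b, c, d` of
`∂Λ_N` with `hexShift r a < hexShift r b < hexShift r c < hexShift r d` (any origin `r ∈ ∂Λ_N`), a
path of sites of `Λ_N ∩ B` from `a` to `c` and a path of sites of `Λ_N ∖ B` from `b` to `d` cannot
both exist (the four points in perimeter order are a cyclic rotation of `(a, b, c, d)`, and each
rotation is an instance of `triBall_not_interleaved`, with `B` or `Bᶜ`). [cite: BollobasRiordan2006, Ch. 7 Lemma 5 p. 169] -/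
theorem triBall_not_interleaved_shift {N : ℕ} (hN : 1 ≤ N) (B : Set (Site 2)) {r a b c d : Site 2}
    (hr : triNorm r = N) (ha : triNorm a = N) (hb : triNorm b = N) (hc : triNorm c = N) (hd : triNorm d = N)
    (h₁ : hexShift N r a < hexShift N r b) (h₂ : hexShift N r b < hexShift N r c)
    (h₃ : hexShift N r c < hexShift N r d)
    (hP : PathIn triGraph ((↑(triBall N) : Set (Site 2)) ∩ B) a c)
    (hQ : PathIn triGraph ((↑(triBall N) : Set (Site 2)) ∩ Bᶜ) b d) : False := by
  have ra := hexPos_range hN ha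
  have rb := hexPos_range hN hb
  have rc := hexPos_range hN hc
  have rd := hexPos_range hN hd
  have rr := hexPos_range hN hr
  have hPcc : PathIn triGraph ((↑(triBall N) : Set (Site 2)) ∩ Bᶜᶜ) a c := by rw [compl_compl]; exact hP
  unfold hexShift at h₁ h₂ h₃
  split_ifs at h₁ h₂ h₃
  all_goals first
    | exact triBall_not_interleaved hN B ha hb hc hd (by omega) (by omega) (by omega) hP hQ
    | exact triBall_not_interleaved hN Bᶜ hb hc hd ha (by omega) (by omega) (by omega) hQ hPcc.symm
    | exact triBall_not_interleaved hN B hc hd ha hb (by omega) (by omega) (by omega) hP.symm hQ.symm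
    | exact triBall_not_interleaved hN Bᶜ hd ha hb hc (by omega) (by omega) (by omega) hQ.symm hPcc

end Literature.Probability.Percolation
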